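import Literature.Computability.MetaComplexity.GFDesignConcrete
import HarnessLib

/-!
# NW designs computable in `AC⁰[p]`: the field `𝔽_p[X]/(P)` as a program on coefficient lists

Sequel of `GFDesignConcrete.lean` (the field `Kt p t = 𝔽_p[X]/(irredPoly p t)`, the indices
`elemIdx`, `univIdx` and the concrete design `designC`). The learner of CIKK Thm. 5.1 for `AC⁰[p]`
must recompute the design on a string machine; this file writes the whole computation as a
first-order functional PROGRAM ON LISTS of residues (little-endian coefficient lists of length
`t`), proves it correct against the field, and thereby gives the closed form of every design
position that the machine layer implements verbatim:

* `ofList l = Σᵢ l[i] Xⁱ` (`coeff_ofList`, `ofList_append`, `monicOf_eq_ofList`); list arithmetic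
  `addL`, `smulL`, `mulXmodL q l` (`X · l mod (Xᵗ + ofList q)`, `ofList_mulXmodL`) and
  `mulmodL q l m` (product mod the modulus, `mk_ofList_mulmodL`);
  `polyValL q bits r = Σ_{j : bits[j]} rʲ mod the modulus` (`mk_ofList_polyValL`);
* base-`p` digits `digitsL t i` and the index `idxL l = Σⱼ l[j] pʲ` (`idxL_digitsL`,
  `digitsL_idxL`, `idxL_lt`);
* the bridge to the field: `toKt l = mk (ofList l)`, `coordEquiv_toKt` (the power-basis
  coordinates of `toKt l` ARE `l`), `elemIdx_toKt = idxL l`, `toKt_digitsL = elemIdx⁻¹`,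
  `univIdx_val`; whence **`designC_val`: position `τ` of block `v` of the concrete design is
  `idxL (polyValL q_P (ofFn v) (digitsL t τ)) + pᵗ · τ`** with `q_P = qP p t` the low coefficients
  of `irredPoly p t`;
* the reducibility test by trial factorization `reducibleL` (`reducibleL_iff`: the monic
  `Xᵗ + ofList q` is reducible iff it is the product of two monics of degrees `d`, `t - d` with
  `1 ≤ d < t`, enumerated by their digit lists; the product is tested MODULO THE CANDIDATE with
  `mulmodL`, since `f g = P ⟺ f g ≡ 0 (mod P)` for such `f, g`), the test `irredTest` of an index
  and the search `irredSearch p t` for the first index passing it: **`irredSearch_eq_irredIdx`** and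
  `qP_eq_digitsL` — the program finds exactly the defining polynomial of `Kt`.

All statements are proved; no named facts are introduced.

## References

* M. Carmosino, R. Impagliazzo, V. Kabanets, A. Kolokolova, *Learning algorithms from natural
  proofs*, CCC 2016, LIPIcs 50, Thm. 3.6 (proof: the field "is described by some polynomial over
  `GF(p)`") [CarmosinoImpagliazzoKabanetsKolokolova2016].
* J. von zur Gathen, J. Gerhard, *Modern Computer Algebra*, 3rd ed., CUP 2013, §4.1–4.2
  (arithmetic in `𝔽_p[X]/(P)` on coefficient vectors). (Schoolbook; proved here.)
-/

namespace Literature.Computability.MetaComplexity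

open Finset Polynomial Literature.Computability.Complexity

namespace GFDesign

variable (p : ℕ) {t : ℕ}

section Lists

/-! ### Coefficient lists as polynomials -/

/-- The polynomial `Σᵢ l[i] Xⁱ` of a little-endian coefficient list. [folklore] -/
noncomputable def ofList : List (ZMod p) → (ZMod p)[X]
  | [] => 0
  | c :: l => C c + X * ofList l

/-- `ofList [] = 0`. [folklore] -/
@[simp] theorem ofList_nil : ofList p [] = 0 := rfl

/-- `ofList (c :: l) = c + X · ofList l`. [folklore] -/
@[simp] theorem ofList_cons (c : ZMod p) (l : List (ZMod p)) : ofList p (c :: l) = C c + X * ofList p l := rfl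

/-- **The coefficients of `ofList l` are the entries of `l`** (zero past the end). [folklore] -/
theorem coeff_ofList : ∀ (l : List (ZMod p)) (i : ℕ), (ofList p l).coeff i = l.getD i 0
  | [], i => by simp
  | c :: l, 0 => by simp
  | c :: l, i + 1 => by
    rw [ofList_cons, coeff_add, coeff_C, if_neg (Nat.succ_ne_zero i), zero_add, coeff_X_mul, coeff_ofList l i]
    simp

/-- `ofList` of a concatenation. [folklore] -/
theorem ofList_append : ∀ l m : List (ZMod p), ofList p (l ++ m) = ofList p l + X ^ l.length * ofList p m
  | [], m => by simp
  | c :: l, m => by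
    rw [List.cons_append, ofList_cons, ofList_cons, ofList_append l m, List.length_cons, pow_succ]
    ring

/-- `ofList` of a block of zeros is `0`. [folklore] -/
theorem ofList_replicate_zero : ∀ n : ℕ, ofList p (List.replicate n 0) = 0
  | 0 => rfl
  | n + 1 => by rw [List.replicate_succ, ofList_cons, ofList_replicate_zero n]; simp

/-- The degree of `ofList l` is `< |l|`. [folklore] -/
theorem degree_ofList_lt (l : List (ZMod p)) : (ofList p l).degree < l.length := by
  rw [degree_lt_iff_coeff_zero]
  intro i hi
  rw [coeff_ofList, List.getD_eq_default _ _ hi]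

/-- Two lists of the same length with the same polynomial are equal. [folklore] -/
theorem ofList_injOn {l m : List (ZMod p)} (hlen : l.length = m.length) (h : ofList p l = ofList p m) : l = m := by
  refine List.ext_getElem hlen fun i h₁ h₂ => ?_
  have := congrArg (fun f => f.coeff i) h
  simp only [coeff_ofList] at this
  rwa [List.getD_eq_getElem _ _ h₁, List.getD_eq_getElem _ _ h₂] at this

/-- The list of the low `t` coefficients of a polynomial. [folklore] -/
noncomputable def lowCoeffs (t : ℕ) (f : (ZMod p)[X]) : List (ZMod p) := List.ofFn fun i : Fin t => f.coeff i

/-- `|lowCoeffs t f| = t`. [folklore] -/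
@[simp] theorem length_lowCoeffs (t : ℕ) (f : (ZMod p)[X]) : (lowCoeffs p t f).length = t := List.length_ofFn

/-- A polynomial of degree `< t` is `ofList` of its low coefficients. [folklore] -/
theorem ofList_lowCoeffs {f : (ZMod p)[X]} (hf : f.degree < t) : ofList p (lowCoeffs p t f) = f := by
  refine Polynomial.ext fun i => ?_
  rw [coeff_ofList, lowCoeffs]
  by_cases hi : i < t
  · rw [List.getD_eq_getElem _ _ (by simpa using hi), List.getElem_ofFn]
  · rw [List.getD_eq_default _ _ (by simpa using hi)]
    push Not at hi
    exact (coeff_eq_zero_of_degree_lt (hf.trans_le (WithBot.coe_le_coe.2 hi))).symm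

/-- The monic with low coefficient list `c`: `ofList (c ++ [1]) = X^{|c|} + ofList c`. [folklore] -/
theorem ofList_append_one (c : List (ZMod p)) : ofList p (c ++ [1]) = X ^ c.length + ofList p c := by
  rw [ofList_append, ofList_cons, ofList_nil, mul_zero, add_zero, map_one, mul_one, add_comm]

/-- `monicOf c = Xᵗ + ofList (the list of c)`. [folklore] -/
theorem monicOf_eq_ofList [Fact p.Prime] (c : Fin t → ZMod p) : monicOf p c = X ^ t + ofList p (List.ofFn c) := by
  rw [monicOf]
  congr 1
  refine Polynomial.ext fun i => ?_
  rw [coeff_ofList, finsetSum_coeff]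
  by_cases hi : i < t
  · rw [List.getD_eq_getElem _ _ (by simpa using hi), List.getElem_ofFn, Finset.sum_eq_single ⟨i, hi⟩]
    · rw [coeff_C_mul, coeff_X_pow, if_pos rfl, mul_one]
    · intro j _ hj
      rw [coeff_C_mul, coeff_X_pow, if_neg (fun h => hj (Fin.ext h.symm)), mul_zero]
    · intro h; exact absurd (Finset.mem_univ _) h
  · rw [List.getD_eq_default _ _ (by simpa using hi)]
    refine Finset.sum_eq_zero fun j _ => ?_
    rw [coeff_C_mul, coeff_X_pow, if_neg (fun h : i = (j : ℕ) => hi (by rw [h]; exact j.isLt)), mul_zero]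

/-! ### Arithmetic on lists -/

/-- Entrywise sum of two lists of the same length. [folklore] -/
def addL (l m : List (ZMod p)) : List (ZMod p) := List.zipWith (· + ·) l m

/-- Scalar multiple. [folklore] -/
def smulL (c : ZMod p) (l : List (ZMod p)) : List (ZMod p) := l.map (c * ·)

/-- Length of `addL`. [folklore] -/
@[simp] theorem length_addL (l m : List (ZMod p)) : (addL p l m).length = min l.length m.length := by
  simp [addL]

/-- Length of `smulL`. [folklore] -/
@[simp] theorem length_smulL (c : ZMod p) (l : List (ZMod p)) : (smulL p c l).length = l.length := by
  simp [smulL]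

/-- `ofList (addL l m) = ofList l + ofList m` for lists of the same length. [folklore] -/
theorem ofList_addL : ∀ (l m : List (ZMod p)), l.length = m.length → ofList p (addL p l m) = ofList p l + ofList p m
  | [], [], _ => by simp [addL]
  | [], _ :: _, h => by simp at h
  | _ :: _, [], h => by simp at h
  | a :: l, b :: m, h => by
    have ih := ofList_addL l m (by simpa using h)
    simp only [addL, List.zipWith_cons_cons, ofList_cons] at ih ⊢
    rw [ih, C_add]
    ring

/-- `ofList (smulL c l) = c · ofList l`. [folklore] -/
theorem ofList_smulL (c : ZMod p) : ∀ l : List (ZMod p), ofList p (smulL p c l) = C c * ofList p l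
  | [] => by simp [smulL]
  | a :: l => by
    have ih := ofList_smulL c l
    simp only [smulL, List.map_cons, ofList_cons] at ih ⊢
    rw [ih, C_mul]
    ring

/-- **Multiplication by `X` modulo `Xᵗ + ofList q`** (`t = |q|`) on a list of length `t`:
shift up and subtract `l[t-1] · q`. [folklore] -/
def mulXmodL (q l : List (ZMod p)) : List (ZMod p) :=
  addL p (0 :: l.take (q.length - 1)) (smulL p (-(l.getD (q.length - 1) 0)) q)

/-- `mulXmodL` preserves the length `t ≥ 1`. [folklore] -/
theorem length_mulXmodL {q l : List (ZMod p)} (hq : q.length = t) (hl : l.length = t) :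
    (mulXmodL p q l).length = t := by
  simp [mulXmodL, hq, hl]; omega

/-- A list of length `t ≥ 1` splits before its last entry. [folklore] -/
theorem ofList_eq_take_add {l : List (ZMod p)} (hl : l.length = t) (ht : t ≠ 0) :
    ofList p l = ofList p (l.take (t - 1)) + C (l.getD (t - 1) 0) * X ^ (t - 1) := by
  conv_lhs => rw [← List.take_append_drop (t - 1) l]
  have hd : l.drop (t - 1) = [l.getD (t - 1) 0] := by
    have hlt : t - 1 < l.length := by omega
    rw [List.drop_eq_getElem_cons hlt, List.drop_of_length_le (by omega), List.getD_eq_getElem _ _ hlt]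
  rw [hd, ofList_append, ofList_cons, ofList_nil, List.length_take, min_eq_left (by omega)]
  simp only [mul_zero, add_zero]
  ring

/-- **`mulXmodL` is multiplication by `X` up to a multiple of the modulus.** [folklore] -/
theorem ofList_mulXmodL {q l : List (ZMod p)} (hq : q.length = t) (hl : l.length = t) (ht : t ≠ 0) :
    ofList p (mulXmodL p q l) = X * ofList p l - C (l.getD (t - 1) 0) * (X ^ t + ofList p q) := by
  rw [mulXmodL, ofList_addL p _ _ (by simp [hq, hl]; omega), ofList_cons, ofList_smulL, hq,
    ofList_eq_take_add p hl ht, map_zero, zero_add, C_neg]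
  have hX : (X : (ZMod p)[X]) ^ t = X * X ^ (t - 1) := by
    rw [← pow_succ']; congr 1; omega
  rw [hX]
  ring

/-- The step of the product loop on the state `(accumulator, l · X^{items read} mod P)`. [folklore] -/
def mulStep (q : List (ZMod p)) (s : List (ZMod p) × List (ZMod p)) (c : ZMod p) : List (ZMod p) × List (ZMod p) :=
  (addL p s.1 (smulL p c s.2), mulXmodL p q s.2)

/-- **Product modulo `Xᵗ + ofList q`** of two lists of length `t`: `Σⱼ m[j] · (Xʲ l mod P)`,
accumulated along `m`. [folklore] -/
def mulmodL (q l m : List (ZMod p)) : List (ZMod p) :=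
  (m.foldl (mulStep p q) (List.replicate q.length 0, l)).1

/-- The product loop keeps both components of length `t`. [folklore] -/
theorem length_foldl_mulStep {q : List (ZMod p)} (hq : q.length = t) :
    ∀ (m : List (ZMod p)) (s : List (ZMod p) × List (ZMod p)), s.1.length = t → s.2.length = t →
      (m.foldl (mulStep p q) s).1.length = t ∧ (m.foldl (mulStep p q) s).2.length = t
  | [], _, h1, h2 => ⟨h1, h2⟩
  | c :: m, s, h1, h2 => by
    rw [List.foldl_cons]
    exact length_foldl_mulStep hq m _ (by simp [mulStep, h1, h2]) (length_mulXmodL p hq h2)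

/-- Length of `mulmodL`. [folklore] -/
theorem length_mulmodL {q l : List (ZMod p)} (hq : q.length = t) (hl : l.length = t)
    (m : List (ZMod p)) : (mulmodL p q l m).length = t :=
  (length_foldl_mulStep p hq m _ (by simp [hq]) hl).1

/-- **The product loop in the quotient ring**: after reading `m`, the state is
`(l · m, l · X^{|m|})` modulo `P = Xᵗ + ofList q`. [folklore] -/
theorem mk_foldl_mulStep {q : List (ZMod p)} (hq : q.length = t) (ht : t ≠ 0) {P : (ZMod p)[X]}
    (hP : P = X ^ t + ofList p q) :
    ∀ (m : List (ZMod p)) (s : List (ZMod p) × List (ZMod p)) (a b : (ZMod p)[X]), s.1.length = t → s.2.length = t →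
      AdjoinRoot.mk P (ofList p s.1) = AdjoinRoot.mk P a → AdjoinRoot.mk P (ofList p s.2) = AdjoinRoot.mk P b →
      AdjoinRoot.mk P (ofList p (m.foldl (mulStep p q) s).1) = AdjoinRoot.mk P (a + b * ofList p m) ∧
        AdjoinRoot.mk P (ofList p (m.foldl (mulStep p q) s).2) = AdjoinRoot.mk P (b * X ^ m.length)
  | [], s, a, b, _, _, ha, hb => by simpa using And.intro ha hb
  | c :: m, s, a, b, h1, h2, ha, hb => by
    rw [List.foldl_cons]
    have h1' : (mulStep p q s c).1.length = t := by simp [mulStep, h1, h2]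
    have h2' : (mulStep p q s c).2.length = t := length_mulXmodL p hq h2
    have ha' : AdjoinRoot.mk P (ofList p (mulStep p q s c).1) = AdjoinRoot.mk P (a + b * C c) := by
      simp only [mulStep]
      rw [ofList_addL p _ _ (by simp [h1, h2]), ofList_smulL, map_add, map_add, ha, map_mul, map_mul, hb,
        AdjoinRoot.mk_C, mul_comm]
    have hb' : AdjoinRoot.mk P (ofList p (mulStep p q s c).2) = AdjoinRoot.mk P (b * X) := by
      simp only [mulStep]
      rw [ofList_mulXmodL p hq h2 ht, map_sub, map_mul, map_mul, hb, ← hP, AdjoinRoot.mk_self, mul_zero, sub_zero,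
        map_mul, mul_comm]
    obtain ⟨hA, hB⟩ := mk_foldl_mulStep hq ht hP m _ (a + b * C c) (b * X) h1' h2' ha' hb'
    refine ⟨?_, ?_⟩
    · rw [hA, ofList_cons]; congr 1; ring
    · rw [hB, List.length_cons, pow_succ']; congr 1; ring

/-- **`mulmodL` multiplies modulo the modulus.** [folklore] -/
theorem mk_ofList_mulmodL {q l m : List (ZMod p)} (hq : q.length = t) (hl : l.length = t) (ht : t ≠ 0)
    {P : (ZMod p)[X]} (hP : P = X ^ t + ofList p q) :
    AdjoinRoot.mk P (ofList p (mulmodL p q l m)) = AdjoinRoot.mk P (ofList p l) * AdjoinRoot.mk P (ofList p m) := by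
  have h := (mk_foldl_mulStep p hq ht hP m (List.replicate q.length 0, l) 0 (ofList p l) (by simp [hq]) hl
    (by rw [ofList_replicate_zero, map_zero]) rfl).1
  rw [mulmodL, h, zero_add, map_mul]

/-! ### The polynomial `A_v(r) = Σ_{j : v j} rʲ` by Horner accumulation -/

/-- The step of the evaluation loop on `(Σ_{j < i, v j} rʲ, rⁱ)`. [folklore] -/
def pvStep (q r : List (ZMod p)) (s : List (ZMod p) × List (ZMod p)) (b : Bool) : List (ZMod p) × List (ZMod p) :=
  (if b then addL p s.1 s.2 else s.1, mulmodL p q s.2 r)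

/-- The constant `1` as a list of length `t`. [folklore] -/
def oneL (t : ℕ) : List (ZMod p) := (List.replicate t (0 : ZMod p)).set 0 1

/-- `|oneL t| = t`. [folklore] -/
@[simp] theorem length_oneL (t : ℕ) : (oneL p t).length = t := by simp [oneL]

/-- `ofList (oneL t) = 1` for `t ≥ 1`. [folklore] -/
theorem ofList_oneL (ht : t ≠ 0) : ofList p (oneL p t) = 1 := by
  obtain ⟨s, rfl⟩ : ∃ s, t = s + 1 := ⟨t - 1, by omega⟩
  rw [oneL, List.replicate_succ, List.set_cons_zero, ofList_cons, ofList_replicate_zero]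
  simp

/-- **`A_v(r)` modulo the modulus, on lists**: `Σ_{j : bits[j]} rʲ`. [cite: CarmosinoImpagliazzoKabanetsKolokolova2016, §3.1 ("`A_i(x) = Σⱼ iⱼ x^{j-1}`")] -/
def polyValL (q : List (ZMod p)) (bits : List Bool) (r : List (ZMod p)) : List (ZMod p) :=
  (bits.foldl (pvStep p q r) (List.replicate q.length 0, oneL p q.length)).1

/-- The evaluation loop keeps both components of length `t`. [folklore] -/
theorem length_foldl_pvStep {q : List (ZMod p)} (r : List (ZMod p)) (hq : q.length = t) :
    ∀ (bits : List Bool) (s : List (ZMod p) × List (ZMod p)), s.1.length = t → s.2.length = t →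
      (bits.foldl (pvStep p q r) s).1.length = t ∧ (bits.foldl (pvStep p q r) s).2.length = t
  | [], _, h1, h2 => ⟨h1, h2⟩
  | b :: bits, s, h1, h2 => by
    rw [List.foldl_cons]
    refine length_foldl_pvStep r hq bits _ ?_ (length_mulmodL p hq h2 r)
    cases b <;> simp [pvStep, h1, h2]

/-- Length of `polyValL`. [folklore] -/
theorem length_polyValL {q : List (ZMod p)} (hq : q.length = t) (bits : List Bool) (r : List (ZMod p)) :
    (polyValL p q bits r).length = t :=
  (length_foldl_pvStep p r hq bits _ (by simp [hq]) (by simp [hq])).1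

/-- **The evaluation loop in the quotient ring.** [folklore] -/
theorem mk_foldl_pvStep {q : List (ZMod p)} (r : List (ZMod p)) (hq : q.length = t) (ht : t ≠ 0)
    {P : (ZMod p)[X]} (hP : P = X ^ t + ofList p q) :
    ∀ (bits : List Bool) (s : List (ZMod p) × List (ZMod p)) (a : AdjoinRoot P) (i : ℕ), s.1.length = t → s.2.length = t →
      AdjoinRoot.mk P (ofList p s.1) = a → AdjoinRoot.mk P (ofList p s.2) = AdjoinRoot.mk P (ofList p r) ^ i →
      AdjoinRoot.mk P (ofList p (bits.foldl (pvStep p q r) s).1) =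
        a + ∑ j ∈ Finset.range bits.length, if bits.getD j false then AdjoinRoot.mk P (ofList p r) ^ (i + j) else 0
  | [], s, a, i, _, _, ha, _ => by simpa using ha
  | b :: bits, s, a, i, h1, h2, ha, hb => by
    rw [List.foldl_cons]
    have h1' : (pvStep p q r s b).1.length = t := by cases b <;> simp [pvStep, h1, h2]
    have h2' : (pvStep p q r s b).2.length = t := length_mulmodL p hq h2 r
    have ha' : AdjoinRoot.mk P (ofList p (pvStep p q r s b).1) =
        a + if b then AdjoinRoot.mk P (ofList p r) ^ i else 0 := by
      cases b
      · simp [pvStep, ha]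
      · simp only [pvStep, if_true]
        rw [ofList_addL p _ _ (by rw [h1, h2]), map_add, ha, hb]
    have hb' : AdjoinRoot.mk P (ofList p (pvStep p q r s b).2) = AdjoinRoot.mk P (ofList p r) ^ (i + 1) := by
      simp only [pvStep]
      rw [mk_ofList_mulmodL p hq h2 ht hP, hb, pow_succ]
    rw [mk_foldl_pvStep r hq ht hP bits _ _ (i + 1) h1' h2' ha' hb', List.length_cons, Finset.sum_range_succ', add_assoc]
    congr 1
    simp only [List.getD_cons_zero, List.getD_cons_succ, Nat.add_zero]
    rw [add_comm]
    congr 1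
    exact Finset.sum_congr rfl fun j _ => by rw [show i + 1 + j = i + (j + 1) by omega]

/-- **`polyValL` computes `Σ_{j : bits[j]} rʲ` modulo the modulus.** [folklore] -/
theorem mk_ofList_polyValL {q : List (ZMod p)} (hq : q.length = t) (ht : t ≠ 0)
    {P : (ZMod p)[X]} (hP : P = X ^ t + ofList p q) (bits : List Bool) (r : List (ZMod p)) :
    AdjoinRoot.mk P (ofList p (polyValL p q bits r)) =
      ∑ j ∈ Finset.range bits.length, if bits.getD j false then AdjoinRoot.mk P (ofList p r) ^ j else 0 := by
  have h := mk_foldl_pvStep p r hq ht hP bits (List.replicate q.length 0, oneL p q.length) 0 0 (by simp [hq])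
    (by simp [hq]) (by rw [ofList_replicate_zero, map_zero]) (by rw [hq, ofList_oneL p ht, map_one, pow_zero])
  rw [polyValL, h, zero_add]
  simp

end Lists

section Digits

/-- **Base-`p` digits reassemble the number**: `Σ_{j<t} (i / pʲ mod p) pʲ = i` for `i < pᵗ`. [folklore] -/
theorem sum_digit_mul_pow : ∀ (t i : ℕ), i < p ^ t → ∑ j ∈ Finset.range t, i / p ^ j % p * p ^ j = i
  | 0, i, hi => by simp at hi; simp [hi]
  | t + 1, i, hi => by
    have hq : i / p < p ^ t := Nat.div_lt_of_lt_mul (by rwa [← pow_succ'])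
    have ih := sum_digit_mul_pow t (i / p) hq
    rw [Finset.sum_range_succ', pow_zero, Nat.div_one, mul_one]
    have hs : ∑ j ∈ Finset.range t, i / p ^ (j + 1) % p * p ^ (j + 1) = p * ∑ j ∈ Finset.range t, i / p / p ^ j % p * p ^ j := by
      rw [Finset.mul_sum]
      refine Finset.sum_congr rfl fun j _ => ?_
      rw [pow_succ', ← Nat.div_div_eq_div_mul]
      ring
    rw [hs, ih, add_comm, Nat.mod_add_div]

/-! ### Base-`p` digits and the index of a list -/

/-- The `t` little-endian base-`p` digits of `i`, as residues. [folklore] -/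
def digitsL (t i : ℕ) : List (ZMod p) := List.ofFn fun j : Fin t => ((i / p ^ (j : ℕ) % p : ℕ) : ZMod p)

/-- `|digitsL t i| = t`. [folklore] -/
@[simp] theorem length_digitsL (t i : ℕ) : (digitsL p t i).length = t := List.length_ofFn

/-- **The index `Σⱼ l[j] pʲ` of a list of residues.** [folklore] -/
def idxL (l : List (ZMod p)) : ℕ := ∑ j ∈ Finset.range l.length, (l.getD j 0).val * p ^ j

variable [hp : Fact p.Prime]

/-- The digit function of a list: entry `j` as an element of `Fin p`. [folklore] -/
def finDigits (l : List (ZMod p)) : Fin l.length → Fin p := fun j => ⟨(l.get j).val, ZMod.val_lt _⟩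

/-- `idxL l` is the number with digit function `finDigits l`. [folklore] -/
theorem val_finFunctionFinEquiv_finDigits (l : List (ZMod p)) :
    (finFunctionFinEquiv (finDigits p l) : ℕ) = idxL p l := by
  rw [finFunctionFinEquiv_apply, idxL, ← Fin.sum_univ_eq_sum_range (fun j => (l.getD j 0).val * p ^ j)]
  refine Finset.sum_congr rfl fun j _ => ?_
  simp only [finDigits, List.get_eq_getElem, List.getD_eq_getElem _ _ j.isLt]

/-- `idxL l < p^{|l|}`. [folklore] -/
theorem idxL_lt (l : List (ZMod p)) : idxL p l < p ^ l.length := by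
  rw [← val_finFunctionFinEquiv_finDigits]; exact Fin.isLt _

/-- The digits of a number below `pᵗ` have index that number. [folklore] -/
theorem idxL_digitsL {i : ℕ} (hi : i < p ^ t) : idxL p (digitsL p t i) = i := by
  rw [idxL, length_digitsL]
  refine Eq.trans (Finset.sum_congr rfl fun j hj => ?_) (sum_digit_mul_pow p t i hi)
  rw [Finset.mem_range] at hj
  rw [digitsL, List.getD_eq_getElem _ _ (by simpa using hj), List.getElem_ofFn, ZMod.val_natCast,
    Nat.mod_eq_of_lt (Nat.mod_lt _ hp.out.pos)]

/-- The list with given digits. [folklore] -/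
theorem digitsL_idxL (l : List (ZMod p)) : digitsL p l.length (idxL p l) = l := by
  have h := finFunctionFinEquiv.symm_apply_apply (finDigits p l)
  refine List.ext_getElem (length_digitsL p _ _) fun j h₁ h₂ => ?_
  have hv := congrArg Fin.val (congrFun h ⟨j, h₂⟩)
  change (finFunctionFinEquiv (finDigits p l) : ℕ) / p ^ j % p = (l.get ⟨j, h₂⟩).val at hv
  rw [val_finFunctionFinEquiv_finDigits] at hv
  simp only [digitsL, List.getElem_ofFn]
  rw [hv, List.get_eq_getElem, ZMod.natCast_zmod_val]

end Digits

section Bridge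

variable [hp : Fact p.Prime]

/-! ### The bridge to `Kt = 𝔽_p[X]/(irredPoly)` -/

/-- **The low coefficients of the defining polynomial**, the list `q_P` with
`irredPoly = Xᵗ + ofList q_P`. [cite: CarmosinoImpagliazzoKabanetsKolokolova2016, Thm. 3.6 (proof)] -/
noncomputable def qP (t : ℕ) (ht : t ≠ 0) : List (ZMod p) := lowCoeffs p t (irredPoly p t ht)

/-- `|qP| = t`. [folklore] -/
@[simp] theorem length_qP (ht : t ≠ 0) : (qP p t ht).length = t := length_lowCoeffs p t _

/-- `irredPoly = Xᵗ + ofList q_P`. [folklore] -/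
theorem irredPoly_eq_qP (ht : t ≠ 0) : irredPoly p t ht = X ^ t + ofList p (qP p t ht) := by
  have h : irredPoly p t ht = X ^ t + ofList p (List.ofFn ((vecIdx p t).symm ⟨irredIdx p t ht, irredIdx_lt p ht⟩)) :=
    monicOf_eq_ofList p _
  suffices hq : qP p t ht = List.ofFn ((vecIdx p t).symm ⟨irredIdx p t ht, irredIdx_lt p ht⟩) by rw [hq]; exact h
  refine List.ext_getElem (by simp) fun i h₁ h₂ => ?_
  simp only [qP, lowCoeffs, List.getElem_ofFn]
  have hi : i < t := by simpa using h₂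
  rw [h, coeff_add, coeff_X_pow, if_neg (Nat.ne_of_lt hi), zero_add, coeff_ofList,
    List.getD_eq_getElem _ _ (by simpa using hi), List.getElem_ofFn]

/-- **A list as a field element**: `toKt l = ofList l mod irredPoly`. [folklore] -/
noncomputable def toKt (ht : t ≠ 0) (l : List (ZMod p)) : Kt p t ht := AdjoinRoot.mk _ (ofList p l)

/-- `toKt` of a sum. [folklore] -/
theorem toKt_addL (ht : t ≠ 0) {l m : List (ZMod p)} (h : l.length = m.length) :
    toKt p ht (addL p l m) = toKt p ht l + toKt p ht m := by
  rw [toKt, ofList_addL p l m h, map_add]; rfl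

/-- `toKt` of a product. [folklore] -/
theorem toKt_mulmodL (ht : t ≠ 0) {l m : List (ZMod p)} (hl : l.length = t) :
    toKt p ht (mulmodL p (qP p t ht) l m) = toKt p ht l * toKt p ht m :=
  mk_ofList_mulmodL p (length_qP p ht) hl ht (irredPoly_eq_qP p ht)

/-- **`toKt (polyValL …) = A_v(r)`** for the bit string `v` read from `bits`. [folklore] -/
theorem toKt_polyValL (ht : t ≠ 0) {ℓ : ℕ} (v : Fin ℓ → Bool) (r : List (ZMod p)) :
    toKt p ht (polyValL p (qP p t ht) (List.ofFn v) r) = polyVal v (toKt p ht r) := by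
  rw [toKt, mk_ofList_polyValL p (length_qP p ht) ht (irredPoly_eq_qP p ht) (List.ofFn v) r, List.length_ofFn, polyVal,
    ← Fin.sum_univ_eq_sum_range]
  refine Finset.sum_congr rfl fun j _ => ?_
  rw [List.getD_eq_getElem _ _ (by simp), List.getElem_ofFn]
  rfl

/-- The power basis is `1, x, …, x^{t-1}`. [folklore] -/
theorem pbasis_apply (ht : t ≠ 0) (i : Fin t) : pbasis p ht i = AdjoinRoot.root (irredPoly p t ht) ^ (i : ℕ) := by
  rw [pbasis, Module.Basis.reindex_apply, PowerBasis.basis_eq_pow, AdjoinRoot.powerBasis'_gen]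
  simp

/-- `ofList l = Σ_{i<|l|} l[i] Xⁱ`. [folklore] -/
theorem ofList_eq_sum : ∀ l : List (ZMod p), ofList p l = ∑ i ∈ Finset.range l.length, C (l.getD i 0) * X ^ i
  | [] => by simp
  | c :: l => by
    rw [ofList_cons, ofList_eq_sum l, List.length_cons, Finset.sum_range_succ', Finset.mul_sum]
    simp only [List.getD_cons_succ, List.getD_cons_zero, pow_zero, mul_one, pow_succ]
    rw [add_comm]
    congr 1
    exact Finset.sum_congr rfl fun i _ => by ring

/-- `toKt l = Σᵢ l[i] · xⁱ` on the power basis (`|l| = t`). [folklore] -/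
theorem toKt_eq_sum (ht : t ≠ 0) {l : List (ZMod p)} (hl : l.length = t) :
    toKt p ht l = ∑ i : Fin t, l.getD i 0 • pbasis p ht i := by
  rw [toKt, ofList_eq_sum, map_sum, hl, ← Fin.sum_univ_eq_sum_range (fun i => AdjoinRoot.mk (irredPoly p t ht) (C (l.getD i 0) * X ^ i))]
  refine Finset.sum_congr rfl fun i _ => ?_
  rw [map_mul, map_pow, AdjoinRoot.mk_C, AdjoinRoot.mk_X, pbasis_apply, Algebra.smul_def]
  rfl

/-- **The power-basis coordinates of `toKt l` are the entries of `l`** (`|l| = t`). [folklore] -/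
theorem coordEquiv_toKt (ht : t ≠ 0) {l : List (ZMod p)} (hl : l.length = t) (i : Fin t) :
    coordEquiv p ht (toKt p ht l) i = l.getD i 0 := by
  have h : (pbasis p ht).equivFun.symm (fun i : Fin t => l.getD i 0) = toKt p ht l := by
    rw [Module.Basis.equivFun_symm_apply, toKt_eq_sum p ht hl]
  rw [coordEquiv, ← h, LinearEquiv.apply_symm_apply]

/-- The inverse of `ZMod.finEquiv` preserves the value. [folklore] -/
theorem val_finEquiv_symm (x : ZMod p) : (((ZMod.finEquiv p : Fin p ≃ ZMod p).symm x : Fin p) : ℕ) = x.val := by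
  have h2 := hp.out.two_le
  obtain ⟨m, hm⟩ : ∃ m, p = m + 1 := ⟨p - 1, by omega⟩
  subst hm
  rfl

/-- **The index of `toKt l` is `idxL l`** (`|l| = t`). [folklore] -/
theorem elemIdx_toKt (ht : t ≠ 0) {l : List (ZMod p)} (hl : l.length = t) :
    ((elemIdx p ht (toKt p ht l) : Fin (p ^ t)) : ℕ) = idxL p l := by
  rw [elemIdx, Equiv.trans_apply, vecIdx, Equiv.trans_apply, finFunctionFinEquiv_apply, idxL, hl,
    ← Fin.sum_univ_eq_sum_range (fun j => (l.getD j 0).val * p ^ j)]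
  refine Finset.sum_congr rfl fun j _ => ?_
  simp only [Equiv.arrowCongr_apply, Function.comp_apply, RingEquiv.toEquiv_eq_coe, Equiv.refl_symm, Equiv.refl_apply,
    LinearEquiv.coe_toEquiv, val_finEquiv_symm, coordEquiv_toKt p ht hl]

/-- **`toKt (digitsL t i)` is the element of index `i`.** [folklore] -/
theorem toKt_digitsL (ht : t ≠ 0) (i : Fin (p ^ t)) : toKt p ht (digitsL p t i) = (elemIdx p ht).symm i := by
  rw [Equiv.eq_symm_apply]
  exact Fin.ext (by rw [elemIdx_toKt p ht (length_digitsL p t i), idxL_digitsL p i.isLt])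

/-- The evaluation points are the elements of index `0, …, N-1`. [folklore] -/
theorem evalPtsC_apply (ht : t ≠ 0) {N : ℕ} (hN : N ≤ p ^ t) (τ : Fin N) :
    evalPtsC p ht N hN τ = toKt p ht (digitsL p t τ) := by
  rw [toKt_digitsL p ht ⟨τ, lt_of_lt_of_le τ.isLt hN⟩]; rfl

/-- **The index of a point of the universe**: `univIdx (a, b) = elemIdx b + pᵗ · elemIdx a`. [folklore] -/
theorem univIdx_val (ht : t ≠ 0) (a b : Kt p t ht) :
    ((univIdx p ht (a, b) : Fin (p ^ t * p ^ t)) : ℕ) = (elemIdx p ht b : ℕ) + p ^ t * (elemIdx p ht a : ℕ) := by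
  simp [univIdx]

/-- **The positions of the concrete design in closed form**: position `τ` of block `v` is
`idxL (polyValL q_P (ofFn v) (digitsL t τ)) + pᵗ · τ` — the column value of block `v` at the
evaluation point of index `τ`, then the pair index. [cite: CarmosinoImpagliazzoKabanetsKolokolova2016, Thm. 3.3 / §3.1] -/
theorem designC_val (ht : t ≠ 0) {N ℓ : ℕ} (hN : N ≤ p ^ t) (v : Fin ℓ → Bool) (τ : Fin N) :
    ((designC p ht N ℓ hN v τ : Fin (p ^ t * p ^ t)) : ℕ) =
      idxL p (polyValL p (qP p t ht) (List.ofFn v) (digitsL p t τ)) + p ^ t * τ := by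
  rw [designC_apply, design_apply, univIdx_val, evalPtsC_apply]
  congr 1
  · rw [← toKt_polyValL p ht v, elemIdx_toKt p ht (length_polyValL p (length_qP p ht) _ _)]
  · rw [toKt_digitsL p ht ⟨τ, lt_of_lt_of_le τ.isLt hN⟩, Equiv.apply_symm_apply]

/-- The column value is `< pᵗ`. [folklore] -/
theorem idxL_polyValL_lt (ht : t ≠ 0) {ℓ : ℕ} (v : Fin ℓ → Bool) (τ : ℕ) :
    idxL p (polyValL p (qP p t ht) (List.ofFn v) (digitsL p t τ)) < p ^ t := by
  have hlen : (polyValL p (qP p t ht) (List.ofFn v) (digitsL p t τ)).length = t :=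
    length_polyValL p (length_qP p ht) (List.ofFn v) (digitsL p t τ)
  have h := idxL_lt p (polyValL p (qP p t ht) (List.ofFn v) (digitsL p t τ))
  rw [hlen] at h
  exact h

end Bridge

section Search

/-! ### The defining polynomial by exhaustive search: a reducibility test on lists -/

/-- The monic of degree `d` with low coefficients the digits of `i`, as a list of length `t`
(`d < t`): `digits ++ [1] ++ 0^{t-d-1}`. [folklore] -/
def monicL (t d i : ℕ) : List (ZMod p) := digitsL p d i ++ [1] ++ List.replicate (t - d - 1) 0

/-- `|monicL t d i| = t` for `d < t`. [folklore] -/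
theorem length_monicL {d : ℕ} (hd : d < t) (i : ℕ) : (monicL p t d i).length = t := by
  simp [monicL]; omega

/-- `ofList (monicL t d i) = X^d + ofList (digits)`. [folklore] -/
theorem ofList_monicL (t d i : ℕ) : ofList p (monicL p t d i) = X ^ d + ofList p (digitsL p d i) := by
  rw [monicL, List.append_assoc, ofList_append, List.singleton_append, ofList_cons, ofList_replicate_zero, length_digitsL]
  simp [add_comm]

variable [hp : Fact p.Prime]

/-- The polynomial of `monicL t d i` is monic of degree `d`. [folklore] -/
theorem monic_ofList_monicL (t d i : ℕ) : (ofList p (monicL p t d i)).Monic ∧ (ofList p (monicL p t d i)).natDegree = d := by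
  rw [ofList_monicL]
  have hlt : (ofList p (digitsL p d i)).degree < d := by
    simpa using degree_ofList_lt p (digitsL p d i)
  refine ⟨(monic_X_pow d).add_of_left (by rwa [degree_X_pow]), ?_⟩
  rw [natDegree_add_eq_left_of_degree_lt (by rwa [degree_X_pow]), natDegree_X_pow]

/-- **The reducibility test**: the monic `X^t + ofList q` (`t = |q| ≥ 1`) is a product of two monics
of degrees `d` and `t - d` with `1 ≤ d < t`, found by trying all digit lists of indices `< Q` (a
unary budget `Q ≥ pᵗ`; larger indices only repeat candidates); products are taken modulo the
candidate itself (`f · g = P ⟺ f · g ≡ 0 mod P` for monic `f, g` with `deg f + deg g = t`).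
[folklore] -/
def reducibleL (Q : ℕ) (q : List (ZMod p)) : Bool :=
  (List.range q.length).any fun d => decide (1 ≤ d) &&
    ((List.range Q).any fun i => (List.range Q).any fun j =>
      decide (mulmodL p q (monicL p q.length d i) (monicL p q.length (q.length - d) j) = List.replicate q.length 0))

/-- A monic polynomial is `ofList` of its low coefficients plus the leading power. [folklore] -/
theorem ofList_lowCoeffs_add_X_pow {f : (ZMod p)[X]} (hf : f.Monic) :
    ofList p (lowCoeffs p f.natDegree f) + X ^ f.natDegree = f := by
  refine Polynomial.ext fun i => ?_
  rw [coeff_add, coeff_ofList, coeff_X_pow, lowCoeffs]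
  rcases lt_trichotomy i f.natDegree with hi | hi | hi
  · rw [List.getD_eq_getElem _ _ (by simpa using hi), List.getElem_ofFn, if_neg hi.ne, add_zero]
  · rw [List.getD_eq_default _ _ (by simp [hi]), if_pos hi, zero_add, hi]; exact hf.coeff_natDegree.symm
  · rw [List.getD_eq_default _ _ (by simp; omega), if_neg hi.ne', add_zero, coeff_eq_zero_of_natDegree_lt hi]

/-- A monic of degree `d` is the polynomial of `monicL t d (its index)`. [folklore] -/
theorem ofList_monicL_idxL {f : (ZMod p)[X]} (hf : f.Monic) (t : ℕ) :
    ofList p (monicL p t f.natDegree (idxL p (lowCoeffs p f.natDegree f))) = f := by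
  have h := digitsL_idxL p (lowCoeffs p f.natDegree f)
  rw [length_lowCoeffs] at h
  rw [ofList_monicL, h, add_comm, ofList_lowCoeffs_add_X_pow p hf]

/-- **Correctness of the reducibility test.** [folklore] -/
theorem reducibleL_iff {q : List (ZMod p)} (hq : q.length = t) (ht : t ≠ 0) {Q : ℕ} (hQ : p ^ t ≤ Q) :
    reducibleL p Q q = true ↔ ¬Irreducible (X ^ t + ofList p q) := by
  set P : (ZMod p)[X] := X ^ t + ofList p q with hP
  have hPm : P.Monic := (monic_X_pow t).add_of_left (by rw [degree_X_pow]; simpa [hq] using degree_ofList_lt p q)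
  have hPd : P.natDegree = t := by
    rw [hP, natDegree_add_eq_left_of_degree_lt (by rw [degree_X_pow]; simpa [hq] using degree_ofList_lt p q), natDegree_X_pow]
  -- the test on a pair of candidates
  have key : ∀ {d : ℕ}, 1 ≤ d → d < t → ∀ i j : ℕ,
      (mulmodL p q (monicL p t d i) (monicL p t (t - d) j) = List.replicate t 0 ↔
        ofList p (monicL p t d i) * ofList p (monicL p t (t - d) j) = P) := by
    intro d hd1 hdt i j
    have hfm := (monic_ofList_monicL p t d i).1
    have hfd := (monic_ofList_monicL p t d i).2
    have hgm := (monic_ofList_monicL p t (t - d) j).1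
    have hgd := (monic_ofList_monicL p t (t - d) j).2
    have hlen : (mulmodL p q (monicL p t d i) (monicL p t (t - d) j)).length = t :=
      length_mulmodL p hq (length_monicL p hdt i) _
    constructor
    · intro h
      have hmk := mk_ofList_mulmodL p hq (length_monicL p hdt i) ht hP (m := monicL p t (t - d) j)
      rw [h, ofList_replicate_zero, map_zero, eq_comm, ← map_mul, AdjoinRoot.mk_eq_zero] at hmk
      refine eq_of_monic_of_dvd_of_natDegree_le hPm (hfm.mul hgm) hmk ?_
      rw [hfm.natDegree_mul hgm, hfd, hgd, hPd]; omega
    · intro h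
      have hmk := mk_ofList_mulmodL p hq (length_monicL p hdt i) ht hP (m := monicL p t (t - d) j)
      rw [← map_mul, h, AdjoinRoot.mk_self, AdjoinRoot.mk_eq_zero] at hmk
      have h0 : ofList p (mulmodL p q (monicL p t d i) (monicL p t (t - d) j)) = 0 :=
        eq_zero_of_dvd_of_degree_lt hmk ((degree_ofList_lt p _).trans_le (by
          rw [hlen, degree_eq_natDegree hPm.ne_zero, hPd]))
      exact ofList_injOn p (by rw [hlen, List.length_replicate]) (by rw [h0, ofList_replicate_zero])
  constructor
  · intro h
    simp only [reducibleL, List.any_eq_true, List.mem_range, Bool.and_eq_true, decide_eq_true_eq, hq] at h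
    obtain ⟨d, hdt, hd1, i, -, j, -, hij⟩ := h
    rw [key hd1 hdt] at hij
    intro hirr
    have hfm := (monic_ofList_monicL p t d i).1
    have hfd := (monic_ofList_monicL p t d i).2
    have hgm := (monic_ofList_monicL p t (t - d) j).1
    have hgd := (monic_ofList_monicL p t (t - d) j).2
    rcases hirr.isUnit_or_isUnit hij.symm with hu | hu
    · have := hfm.natDegree_eq_zero.2 (hfm.isUnit_iff.1 hu); omega
    · have := hgm.natDegree_eq_zero.2 (hgm.isUnit_iff.1 hu); omega
  · intro h
    have hP1 : P ≠ 1 := fun h1 => by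
      have := congrArg natDegree h1; rw [hPd, natDegree_one] at this; exact ht this
    rw [hPm.irreducible_iff_natDegree] at h
    push Not at h
    obtain ⟨f, g, hf, hg, hfg, hf0, hg0⟩ := h hP1
    have hdeg : f.natDegree + g.natDegree = t := by rw [← hf.natDegree_mul hg, hfg, hPd]
    simp only [reducibleL, List.any_eq_true, List.mem_range, Bool.and_eq_true, decide_eq_true_eq, hq]
    have hpow : ∀ {d : ℕ}, d ≤ t → p ^ d ≤ Q := fun hd => (Nat.pow_le_pow_right hp.out.pos hd).trans hQ
    refine ⟨f.natDegree, by omega, Nat.one_le_iff_ne_zero.2 hf0, idxL p (lowCoeffs p f.natDegree f), ?_,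
      idxL p (lowCoeffs p g.natDegree g), ?_, ?_⟩
    · have := idxL_lt p (lowCoeffs p f.natDegree f)
      rw [length_lowCoeffs] at this
      exact this.trans_le (hpow (by omega))
    · have := idxL_lt p (lowCoeffs p g.natDegree g)
      rw [length_lowCoeffs] at this
      exact this.trans_le (hpow (by omega))
    · rw [key (Nat.one_le_iff_ne_zero.2 hf0) (by omega), ofList_monicL_idxL p hf,
        show t - f.natDegree = g.natDegree by omega, ofList_monicL_idxL p hg, hfg]

/-- **The irreducibility test of index `m`**: the monic with low coefficients the digits of `m`.
[folklore] -/
def irredTest (t Q m : ℕ) : Bool := !reducibleL p Q (digitsL p t m)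

/-- The coefficient vector enumerated by `vecIdx` at index `m` lists as the digits of `m`. [folklore] -/
theorem ofFn_vecIdx_symm {m : ℕ} (hm : m < p ^ t) : List.ofFn ((vecIdx p t).symm ⟨m, hm⟩) = digitsL p t m := by
  refine List.ext_getElem (by simp) fun j h₁ h₂ => ?_
  simp only [List.getElem_ofFn, digitsL]
  have hj : j < t := by simpa using h₁
  simp only [vecIdx, Equiv.symm_trans_apply, Equiv.arrowCongr_symm, Equiv.arrowCongr_apply, Function.comp_apply,
    Equiv.refl_symm, Equiv.refl_apply, RingEquiv.toEquiv_eq_coe, Equiv.symm_symm]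
  rw [← ZMod.natCast_zmod_val ((ZMod.finEquiv p : Fin p ≃ ZMod p) (finFunctionFinEquiv.symm ⟨m, hm⟩ ⟨j, hj⟩))]
  congr 1
  have hv : ∀ y : Fin p, ((ZMod.finEquiv p : Fin p ≃ ZMod p) y).val = (y : ℕ) := by
    intro y
    obtain ⟨n, hn⟩ : ∃ n, p = n + 1 := ⟨p - 1, by have := hp.out.two_le; omega⟩
    subst hn
    rfl
  rw [hv]
  rfl

/-- The test decides irreducibility of the monic of index `m`. [folklore] -/
theorem irredTest_eq_true_iff (ht : t ≠ 0) {Q : ℕ} (hQ : p ^ t ≤ Q) {m : ℕ} (hm : m < p ^ t) :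
    irredTest p t Q m = true ↔ Irreducible (monicOf p ((vecIdx p t).symm ⟨m, hm⟩)) := by
  rw [irredTest, Bool.not_eq_true', ← Bool.not_eq_true, reducibleL_iff p (length_digitsL p t m) ht hQ, not_not,
    monicOf_eq_ofList, ofFn_vecIdx_symm]

/-- **The search**: the first index below the budget `Q` passing the irreducibility test (`0` if
none). [cite: CarmosinoImpagliazzoKabanetsKolokolova2016, Thm. 3.6 (proof: exhaustive search for the field)] -/
def irredSearch (t Q : ℕ) : ℕ := ((List.range Q).find? (irredTest p t Q)).getD 0

/-- **The search finds `irredIdx`** (budget `Q ≥ pᵗ`). [folklore] -/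
theorem irredSearch_eq_irredIdx (ht : t ≠ 0) {Q : ℕ} (hQ : p ^ t ≤ Q) : irredSearch p t Q = irredIdx p t ht := by
  have h : (List.range Q).find? (irredTest p t Q) = some (irredIdx p t ht) := by
    rw [List.find?_range_eq_some]
    refine ⟨(irredTest_eq_true_iff p ht hQ (irredIdx_lt p ht)).2 (irreducible_irredPoly p ht),
      List.mem_range.2 ((irredIdx_lt p ht).trans_le hQ), fun j hj => ?_⟩
    rw [Bool.not_eq_true', ← Bool.not_eq_true, irredTest_eq_true_iff p ht hQ (hj.trans (irredIdx_lt p ht))]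
    exact irredIdx_min p ht hj
  rw [irredSearch, h]; rfl

/-- **The modulus list of the machine is `q_P`**: the digits of the index found by the search. [folklore] -/
theorem qP_eq_digitsL (ht : t ≠ 0) {Q : ℕ} (hQ : p ^ t ≤ Q) : qP p t ht = digitsL p t (irredSearch p t Q) := by
  rw [irredSearch_eq_irredIdx p ht hQ, ← ofFn_vecIdx_symm p (irredIdx_lt p ht)]
  refine List.ext_getElem (by simp) fun i h₁ h₂ => ?_
  have hi : i < t := by simpa using h₂
  simp only [qP, lowCoeffs, List.getElem_ofFn]
  rw [irredPoly, coeff_monicOf p _ ⟨i, hi⟩]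

end Search

section Program

/-! ### The whole column program: `t` and the modulus from the budget `Q = pᵗ`, then the value -/

/-- **The exponent read off the unary budget**: the number of `i < Q` with `p^{i+1} ≤ Q`
(`= t` for `Q = pᵗ`). [folklore] -/
def tOf (Q : ℕ) : ℕ := ((List.range Q).filter fun i => decide (p ^ (i + 1) ≤ Q)).length

variable [hp : Fact p.Prime]

/-- `tOf (pᵗ) = t`. [folklore] -/
theorem tOf_pow (t : ℕ) : tOf p (p ^ t) = t := by
  have h1 := hp.out.one_lt
  have hfilter : (List.range (p ^ t)).filter (fun i => decide (p ^ (i + 1) ≤ p ^ t)) = List.range t := by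
    have ht : t ≤ p ^ t := (Nat.lt_pow_self h1).le
    rw [show p ^ t = t + (p ^ t - t) by omega, List.range_add, List.filter_append]
    rw [show t + (p ^ t - t) = p ^ t by omega]
    have hA : (List.range t).filter (fun i => decide (p ^ (i + 1) ≤ p ^ t)) = List.range t :=
      List.filter_eq_self.2 fun i hi => by
        rw [decide_eq_true_eq]; exact Nat.pow_le_pow_right h1.le (List.mem_range.1 hi)
    have hB : ((List.range (p ^ t - t)).map (t + ·)).filter (fun i => decide (p ^ (i + 1) ≤ p ^ t)) = [] :=
      List.filter_eq_nil_iff.2 fun i hi => by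
        obtain ⟨j, -, rfl⟩ := List.mem_map.1 hi
        rw [decide_eq_true_eq, not_le]
        exact Nat.pow_lt_pow_right h1 (by omega)
    rw [hA, hB, List.append_nil]
  rw [tOf, hfilter, List.length_range]

/-- `p^{tOf Q} ≤ Q` for `Q ≥ 1`. [folklore] -/
theorem pow_tOf_le {Q : ℕ} (hQ : 1 ≤ Q) : p ^ tOf p Q ≤ Q := by
  have h1 := hp.out.one_lt
  -- the filtered indices are an initial segment `[0, s)` with `p^s ≤ Q`
  set s := Nat.log p Q with hs
  have hfilter : (List.range Q).filter (fun i => decide (p ^ (i + 1) ≤ Q)) = List.range s := by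
    have hsQ : s ≤ Q := (Nat.log_lt_self p (by omega)).le
    rw [show Q = s + (Q - s) by omega, List.range_add, List.filter_append, show s + (Q - s) = Q by omega]
    have hA : (List.range s).filter (fun i => decide (p ^ (i + 1) ≤ Q)) = List.range s :=
      List.filter_eq_self.2 fun i hi => by
        rw [decide_eq_true_eq]
        exact Nat.pow_le_of_le_log (by omega) (List.mem_range.1 hi)
    have hB : ((List.range (Q - s)).map (s + ·)).filter (fun i => decide (p ^ (i + 1) ≤ Q)) = [] :=
      List.filter_eq_nil_iff.2 fun i hi => by
        obtain ⟨j, -, rfl⟩ := List.mem_map.1 hi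
        rw [decide_eq_true_eq, not_le]
        exact Nat.lt_pow_of_log_lt h1 (by omega)
    rw [hA, hB, List.append_nil]
  rw [tOf, hfilter, List.length_range]
  exact Nat.pow_log_le_self p (by omega)

/-- **The modulus list computed from the budget**: the digits of the index found by the search at
exponent `tOf Q`. [folklore] -/
def qOf (Q : ℕ) : List (ZMod p) := digitsL p (tOf p Q) (irredSearch p (tOf p Q) Q)

/-- `|qOf Q| = tOf Q`. [folklore] -/
@[simp] theorem length_qOf (Q : ℕ) : (qOf p Q).length = tOf p Q := length_digitsL p _ _

/-- At `Q = pᵗ` the computed modulus is `q_P`. [folklore] -/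
theorem qOf_pow (ht : t ≠ 0) : qOf p (p ^ t) = qP p t ht := by
  rw [qOf, tOf_pow, qP_eq_digitsL p ht le_rfl]

/-- The bit string of length `ℓ` read from a raw string (default `false` past its end). [folklore] -/
def bitsOf (ℓ : ℕ) (vbits : List Bool) : List Bool := List.ofFn fun j : Fin ℓ => vbits.getD j false

omit hp in
/-- Reading a genuine bit string returns it. [folklore] -/
theorem bitsOf_ofFn {ℓ : ℕ} (v : Fin ℓ → Bool) : bitsOf ℓ (List.ofFn v) = List.ofFn v := by
  unfold bitsOf
  congr 1
  funext j
  rw [List.getD_eq_getElem _ _ (by simp), List.getElem_ofFn]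

/-- **The column value of the machine**: on the budget `Q`, the seed length `ℓ`, a raw bit string
and a column `τ` — the index of `A_v(r_τ)` computed entirely on lists. [cite: CarmosinoImpagliazzoKabanetsKolokolova2016, §3.1 / Thm. 3.6] -/
def colValL (Q ℓ : ℕ) (vbits : List Bool) (τ : ℕ) : ℕ :=
  idxL p (polyValL p (qOf p Q) (bitsOf ℓ vbits) (digitsL p (tOf p Q) τ))

/-- The column value is below the budget (`Q ≥ 1`). [folklore] -/
theorem colValL_lt {Q : ℕ} (hQ : 1 ≤ Q) (ℓ : ℕ) (vbits : List Bool) (τ : ℕ) : colValL p Q ℓ vbits τ < Q := by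
  have h := idxL_lt p (polyValL p (qOf p Q) (bitsOf ℓ vbits) (digitsL p (tOf p Q) τ))
  rw [length_polyValL p (length_qOf p Q)] at h
  exact h.trans_le (pow_tOf_le p hQ)

/-- The column value never exceeds the budget (for `Q = 0` the modulus is empty and the value is `0`). [folklore] -/
theorem colValL_le (Q ℓ : ℕ) (vbits : List Bool) (τ : ℕ) : colValL p Q ℓ vbits τ ≤ Q := by
  rcases Nat.eq_zero_or_pos Q with rfl | hQ
  · have ht : tOf p 0 = 0 := by simp [tOf]
    have hlen : (polyValL p (qOf p 0) (bitsOf ℓ vbits) (digitsL p (tOf p 0) τ)).length = 0 := by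
      rw [length_polyValL p (length_qOf p 0), ht]
    rw [colValL, List.eq_nil_of_length_eq_zero hlen]
    simp [idxL]
  · exact (colValL_lt p hQ ℓ vbits τ).le

/-- **The concrete design, recomputed**: position `τ` of block `v` of `designC` is
`colValL (pᵗ) ℓ (ofFn v) τ + pᵗ · τ`. [cite: CarmosinoImpagliazzoKabanetsKolokolova2016, Thm. 3.3 / §3.1] -/
theorem designC_val_colValL (ht : t ≠ 0) {N ℓ : ℕ} (hN : N ≤ p ^ t) (v : Fin ℓ → Bool) (τ : Fin N) :
    ((designC p ht N ℓ hN v τ : Fin (p ^ t * p ^ t)) : ℕ) = colValL p (p ^ t) ℓ (List.ofFn v) τ + p ^ t * τ := by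
  rw [designC_val, colValL, qOf_pow p ht, bitsOf_ofFn, tOf_pow]

end Program

end GFDesign

end Literature.Computability.MetaComplexity
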